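import Summits.CriticalPhenomena.PercolationContinuityZ3.Theorems.PercNearOneGluingNoHeavyPcintChainBondEvent
import Summits.CriticalPhenomena.PercolationContinuityZ3.Theorems.PercNearOneGluingNoHeavyPcintThirdBondIneq
import HarnessLib

/-!
# PCINT lane, reduction B3t (`chordthird_cw`): `t`-units and the per-site bound

Cell `prim-pcint` (PAPER-2 track (iii): certified intervals for `p_c(ℤ^d)`), seat `prim-pcint-2` (gen 4); support file
(`--supports stmt-CriticalPhenomena-4575`).  Does NOT build on p205010.  Memo: `run/shared/lean/prim/pcint/REDUCTIONS.md` §B3t.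

On top of the B3c units of `…ChainBondUnits` (base unit `paysAt k`, bonus unit `bonusAt k`), incidence `k` of an off-path
site carries a `t`-UNIT (`tUnitAt k`) when it pays a base unit, `k ≥ 2` (it is at least the third incidence) and its gap to
incidence `k - 1` is `≥ 4`; `tUnits = #tSet`, `sUnits = detUnits - tUnits`.  Counting (`card_goodSet_add_tUnits_le`,
`card_goodSet_add_tUnits_le_of_first`): the `t`-pairs `(k-1, k)` and the good (gap-`2`) consecutive pairs are disjoint
families of consecutive pairs not containing the first pair (unless it is good), so `g + tUnits ≤ r - 1`, and `≤ r - 2`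
when the first pair is not good.  With `…ThirdBondIneq` this gives the per-site bound
**`real_siteEvt_le_pow2`**: `P(siteEvt o γ w) ≤ s^{sUnits + 2·#badFiber} · t^{tUnits}`.
-/

noncomputable section

namespace Summit.CriticalPhenomena.PercolationContinuityZ3.Theorems.Pcint

open Finset MeasureTheory Literature.Probability.Percolation Literature.Probability.LatticeModels

variable {d n : ℕ}

namespace ChainBond

/-! ### `t`-units -/

/-- Incidence `k` carries a `t`-UNIT: it pays a base unit, is at least the third incidence (`k ≥ 2`), and is at gap `≥ 4`
from the previous incidence. [folklore] -/
def tUnitAt (kc : ℕ) (γ : Fin n → Fin d × Bool) (w : Site d) (k : ℕ) : Prop :=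
  paysAt kc γ w k ∧ 2 ≤ k ∧ incAt γ w (k - 1) + 4 ≤ incAt γ w k

/-- `tUnitAt` is decidable. [folklore] -/
instance tUnitAt.decidable (kc : ℕ) (γ : Fin n → Fin d × Bool) (w : Site d) (k : ℕ) : Decidable (tUnitAt kc γ w k) := by
  unfold tUnitAt; infer_instance

/-- The `t`-unit indices. [folklore] -/
def tSet (kc : ℕ) (γ : Fin n → Fin d × Bool) (w : Site d) : Finset ℕ :=
  (range (incTimes γ w).card).filter fun k => tUnitAt kc γ w k

/-- Membership in `tSet`. [folklore] -/
theorem mem_tSet {kc : ℕ} {γ : Fin n → Fin d × Bool} {w : Site d} {k : ℕ} : k ∈ tSet kc γ w ↔ tUnitAt kc γ w k := by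
  rw [tSet, mem_filter, mem_range]
  exact ⟨fun h => h.2, fun h => ⟨h.1.2.1, h⟩⟩

/-- The number of `t`-units of the site. [folklore] -/
def tUnits (kc : ℕ) (γ : Fin n → Fin d × Bool) (w : Site d) : ℕ := (tSet kc γ w).card

/-- `t`-units are base units. [folklore] -/
theorem tSet_subset_paySet (kc : ℕ) (γ : Fin n → Fin d × Bool) (w : Site d) : tSet kc γ w ⊆ paySet kc γ w :=
  fun _ hk => mem_paySet.2 (mem_tSet.1 hk).1

/-- `tUnits ≤ detUnits`. [folklore] -/
theorem tUnits_le_detUnits (kc : ℕ) (γ : Fin n → Fin d × Bool) (w : Site d) : tUnits kc γ w ≤ detUnits kc γ w :=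
  (card_le_card (tSet_subset_paySet kc γ w)).trans (Nat.le_add_right _ _)

/-- The number of `s`-units of the site (base or bonus units that are not `t`-units). [folklore] -/
def sUnits (kc : ℕ) (γ : Fin n → Fin d × Bool) (w : Site d) : ℕ := detUnits kc γ w - tUnits kc γ w

/-- `sUnits + tUnits = detUnits`. [folklore] -/
theorem sUnits_add_tUnits (kc : ℕ) (γ : Fin n → Fin d × Bool) (w : Site d) :
    sUnits kc γ w + tUnits kc γ w = detUnits kc γ w := Nat.sub_add_cancel (tUnits_le_detUnits kc γ w)

/-! ### Counting: good pairs and `t`-pairs are disjoint consecutive pairs -/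

/-- The `t`-pairs, indexed by their lower index `k - 1`, among the consecutive pairs `0 … r-2`; none is the first pair and
none is a gap-`2` pair. [folklore] -/
theorem image_tSet_subset (kc : ℕ) (γ : Fin n → Fin d × Bool) (w : Site d) :
    (tSet kc γ w).image (· - 1) ⊆ ((range ((incTimes γ w).card - 1)).erase 0).filter
      fun j => incAt γ w j + 4 ≤ incAt γ w (j + 1) := by
  intro j hj
  obtain ⟨k, hk, rfl⟩ := mem_image.1 hj
  obtain ⟨⟨_, hkr, -, -⟩, hk2, hgap⟩ := mem_tSet.1 hk
  refine mem_filter.2 ⟨mem_erase.2 ⟨by omega, mem_range.2 (by omega)⟩, ?_⟩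
  rw [show k - 1 + 1 = k by omega]; exact hgap

/-- `#(tSet.image (· - 1)) = tUnits`. [folklore] -/
theorem card_image_tSet (kc : ℕ) (γ : Fin n → Fin d × Bool) (w : Site d) :
    ((tSet kc γ w).image (· - 1)).card = tUnits kc γ w := by
  refine card_image_of_injOn fun k hk k' hk' h => ?_
  have h2 := (mem_tSet.1 (mem_coe.1 hk)).2.1
  have h2' := (mem_tSet.1 (mem_coe.1 hk')).2.1
  omega

/-- **Counting**: `#goodSet + tUnits + 1 ≤ r` (or `r = 0`). [folklore] -/
theorem card_goodSet_add_tUnits_le (kc : ℕ) (o : Orders d n) (γ : Fin n → Fin d × Bool) (w : Site d) :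
    (goodSet o γ w).card + tUnits kc γ w + 1 ≤ (incTimes γ w).card ∨ (incTimes γ w).card = 0 := by
  classical
  set r := (incTimes γ w).card with hr
  by_cases hr0 : r = 0
  · exact Or.inr hr0
  left
  have hdisj : Disjoint (goodSet o γ w) ((tSet kc γ w).image (· - 1)) := by
    rw [Finset.disjoint_left]
    intro j hg ht
    have h1 := (mem_filter.1 hg).2.1
    have h2 := (mem_filter.1 (image_tSet_subset kc γ w ht)).2
    omega
  have hsub : goodSet o γ w ∪ (tSet kc γ w).image (· - 1) ⊆ range (r - 1) :=
    union_subset (fun j hj => (mem_filter.1 hj).1) fun j hj => mem_of_mem_erase (mem_filter.1 (image_tSet_subset kc γ w hj)).1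
  have := card_le_card hsub
  rw [card_union_of_disjoint hdisj, card_image_tSet, card_range] at this
  omega

/-- **Counting, first pair not good**: `#goodSet + tUnits + 2 ≤ r`. [folklore] -/
theorem card_goodSet_add_tUnits_le_of_first {kc : ℕ} {o : Orders d n} {γ : Fin n → Fin d × Bool} {w : Site d}
    (hr : 2 ≤ (incTimes γ w).card)
    (h0 : ¬ (incAt γ w 1 = incAt γ w 0 + 2 ∧ ¬ (cornerSite γ (incAt γ w 0) = w ∧ IsBad o γ (incAt γ w 0)))) :
    (goodSet o γ w).card + tUnits kc γ w + 2 ≤ (incTimes γ w).card := by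
  classical
  set r := (incTimes γ w).card with hr'
  have hdisj : Disjoint (goodSet o γ w) ((tSet kc γ w).image (· - 1)) := by
    rw [Finset.disjoint_left]
    intro j hg ht
    have h1 := (mem_filter.1 hg).2.1
    have h2 := (mem_filter.1 (image_tSet_subset kc γ w ht)).2
    omega
  have hsub : goodSet o γ w ∪ (tSet kc γ w).image (· - 1) ⊆ (range (r - 1)).erase 0 := by
    refine union_subset (fun j hj => ?_) fun j hj => (mem_filter.1 (image_tSet_subset kc γ w hj)).1
    obtain ⟨hj1, hj2⟩ := mem_filter.1 hj
    refine mem_erase.2 ⟨fun hj0 => ?_, hj1⟩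
    subst hj0
    exact h0 hj2
  have := card_le_card hsub
  rw [card_union_of_disjoint hdisj, card_image_tSet, card_erase_of_mem (mem_range.2 (by omega)), card_range] at this
  omega

/-! ### The per-site bound with two kinds of units -/

/-- **Per-site bound in units (B3t)**: `P(siteEvt o γ w) ≤ s^{sUnits + 2·#badFiber} · t^{tUnits}` for reals with
`0 ≤ p ≤ 1`, `1 - p² ≤ s²`, `0 ≤ t ≤ s ≤ 1`, `(1-p)(1+2p) ≤ t(1+p)`, `p²(1-p) ≤ s²(s-t)`, and `kc ≥ 2`. [folklore] -/
theorem real_siteEvt_le_pow2 (p : unitInterval) {s t : ℝ} (hps : 1 - (p : ℝ) ^ 2 ≤ s ^ 2) (hs1 : s ≤ 1) (ht0 : 0 ≤ t)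
    (hts : t ≤ s) (htp : (1 - (p : ℝ)) * (1 + 2 * p) ≤ t * (1 + p)) (hst : (p : ℝ) ^ 2 * (1 - p) ≤ s ^ 2 * (s - t))
    {kc : ℕ} (hkc : 2 ≤ kc) {o : Orders d n} {γ : Fin n → Fin d × Bool} (hsaw : IsSAW γ) {w : Site d}
    (hw : w ∉ pathSites γ) :
    (bondPercolation (zdGraph d) p).real (siteEvt o γ w) ≤
      s ^ (sUnits kc γ w + 2 * (badFiber o γ w).card) * t ^ tUnits kc γ w := by
  classical
  have hp0 : (0 : ℝ) ≤ p := p.2.1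
  have hp1 : (p : ℝ) ≤ 1 := p.2.2
  set r := (incTimes γ w).card with hr
  have hunits := detUnits_add_le hkc γ w
  have hfib := card_badFiber_le_one o γ w
  have hP := real_siteEvt_le_siteProb p (o := o) hsaw hw
  have hst' := sUnits_add_tUnits kc γ w
  rw [← hr] at hP hunits
  by_cases hr1 : r ≤ 1
  · have hdu : detUnits kc γ w = 0 := detUnits_eq_zero_of_card_le_one (by rw [← hr]; exact hr1)
    have htu : tUnits kc γ w = 0 := by have := tUnits_le_detUnits kc γ w; omega
    have hsu : sUnits kc γ w = 0 := by unfold sUnits; omega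
    have hbf : badFiber o γ w = ∅ := by
      rw [Finset.eq_empty_iff_forall_notMem]
      intro x hx
      have := (eq_incAt_zero_of_mem_badFiber hx).2.1.1
      omega
    rw [htu, hsu, hbf, card_empty, mul_zero, add_zero, pow_zero, pow_zero, mul_one]
    exact measureReal_le_one
  obtain ⟨m, hm⟩ : ∃ m, r = m + 2 := ⟨r - 2, by omega⟩
  rw [hm] at hP
  have hcount := card_goodSet_add_tUnits_le kc o γ w
  rw [← hr] at hcount
  by_cases h0 : incAt γ w 1 = incAt γ w 0 + 2 ∧ ¬ (cornerSite γ (incAt γ w 0) = w ∧ IsBad o γ (incAt γ w 0))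
  · -- the first pair is a good corner pair: no bad corner in the fibre, `firstCorner`, `0 ∈ goodSet`
    have hbf : badFiber o γ w = ∅ := by
      rw [Finset.eq_empty_iff_forall_notMem]
      intro x hx
      obtain ⟨hx0, -, hbad⟩ := eq_incAt_zero_of_mem_badFiber hx
      have hcw : cornerSite γ (incAt γ w 0) = w := by rw [← hx0]; exact (mem_filter.1 hx).2
      exact h0.2 ⟨hcw, by rw [← hx0]; exact hbad⟩
    have hfc : firstCorner γ w := ⟨by rw [← hr]; omega, h0.1⟩
    rw [if_pos hfc] at hunits
    have hg0 : 0 ∈ goodSet o γ w := by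
      rw [goodSet, mem_filter, mem_range]; exact ⟨by rw [← hr]; omega, h0⟩
    have hg1 : 1 ≤ (goodSet o γ w).card := card_pos.2 ⟨0, hg0⟩
    rw [hbf, card_empty, mul_zero, add_zero]
    refine hP.trans (siteProb_le_pow2_of_first_good hp0 hp1 hs1 ht0 hts htp hst hg1 ?_ ?_)
    · rcases hcount with h | h <;> omega
    · omega
  · -- the first pair is not good: `g + b ≤ r - 2`, `a + b ≤ r`
    have hg := card_goodSet_add_tUnits_le_of_first (kc := kc) (o := o) (by rw [← hr]; omega) h0
    rw [← hr] at hg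
    refine hP.trans (siteProb_le_pow2_of_first_bad hp0 hp1 hps hs1 ht0 hts htp hst (by omega) ?_)
    by_cases hne : (badFiber o γ w).Nonempty
    · obtain ⟨x, hx⟩ := hne
      obtain ⟨-, hfc, -⟩ := eq_incAt_zero_of_mem_badFiber hx
      have hcard1 : (badFiber o γ w).card = 1 := le_antisymm hfib (card_pos.2 ⟨x, hx⟩)
      rw [if_pos hfc] at hunits
      rw [hcard1]; omega
    · rw [Finset.not_nonempty_iff_eq_empty] at hne
      rw [hne, card_empty]
      split_ifs at hunits <;> omega

/-! ### Totals -/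

/-- Total number of `t`-units of a word. [folklore] -/
def tTotal (kc : ℕ) (γ : Fin n → Fin d × Bool) : ℕ := ∑ w ∈ offSites γ, tUnits kc γ w

/-- Total number of `s`-units of a word. [folklore] -/
def sTotal (kc : ℕ) (γ : Fin n → Fin d × Bool) : ℕ := ∑ w ∈ offSites γ, sUnits kc γ w

/-- `sTotal + tTotal = detTotal`. [folklore] -/
theorem sTotal_add_tTotal (kc : ℕ) (γ : Fin n → Fin d × Bool) : sTotal kc γ + tTotal kc γ = detTotal kc γ := by
  rw [sTotal, tTotal, detTotal, ← sum_add_distrib]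
  exact sum_congr rfl fun w _ => sUnits_add_tUnits kc γ w

/-- The symmetric (order-averaged) B3t weight of a word:
`pⁿ (1-p)^{#chords} s^{sTotal} t^{tTotal} ((1+s²)/2)^{cornerTotal}`. [folklore] -/
def thirdBondWeight (p s t : ℝ) (kc : ℕ) (γ : Fin n → Fin d × Bool) : ℝ :=
  p ^ n * (1 - p) ^ (chordEdges γ).card * s ^ sTotal kc γ * t ^ tTotal kc γ * ((1 + s ^ 2) / 2) ^ cornerTotal γ

end ChainBond

end Summit.CriticalPhenomena.PercolationContinuityZ3.Theorems.Pcint
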